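import Summits.ResolutionOfSingularities.ResolutionOfSingularities.Theorems.WeightedInvariantHypersurfaceCentreAssemblyPlusStalk
import HarnessLib

/-!
# (o25) «F-AQS-T in the kernel», piece (γ2) — BRICK A: the affine stalk model of the datum-style cobordant blow-up

Route `ResolutionOfSingularities/WeightedInvariant`, crux `Theses.WeightedInvariant.HypersurfaceCentreConstruction`
(stmt-ResolutionOfSingularities-19897), door line `local-engine`, rung `e = 1`: ORDER (o25) of res-L1-w43-plan-1 (make the named fact
`AbramovichQuekSchober2025_heightTwoCentre` a kernel theorem), design of record res-type-092's `O25-DESIGN.md` §2, piece **(γ2)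
PLUS-STALK** = «the datum-style twin of the K4-E stalk chain (I)(II)(III) on `R.cobordantPlus U`» (holder res-type-089, second hand
res-type-057; RULING gen 9 #6 and its AMENDMENT 2026-08-27T09:50Z).

This file is the CUT-INDEPENDENT first third of (γ2): for ANY commutative ring `A`, ANY sequence of ideals `I : ℕ → Ideal A` and
ANY point `b` of the cobordant blow-up `B₊ = Spec A[t⁻¹, Iₙ tⁿ] ∖ Vert` (`affineCobordantBlowup.plus I`), read as the prime `q` of
`extReesAlgebra I` under `b`:
* **(I)** `exists_stalk_ringEquiv_plus` — a ring isomorphism `Ψ₀ : 𝒪_{B₊, b} ≃+* (A[t⁻¹, Iₙ tⁿ])_q` carrying, for EVERY ideal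
  `𝔞 ≤ A`, the stalk of the strict transform `σˢ(𝔞)|_{B₊}` (`affineCobordantBlowup.strictTransformPlus I 𝔞`) onto the
  `t⁻¹`-saturation `⋃ₙ (𝔞 · (A[t⁻¹, Iₙ tⁿ])_q : (t⁻¹/1)ⁿ)` (K4-A along the open immersion `B₊ ↪ B`, K4-B on `Spec` with the
  localisation model — res-type-089's `exists_stalk_ringEquiv_localization_Spec` — and `strictTransform_eq_iSup_colon` +
  `map_iSup_colon_singleton_pow`);
* **(II)** `plusπ_apply_asIdeal` — the base point `σ₊(b) ∈ Spec A` is the prime `q ∩ A`;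
* **(III)** `not_vertexIdeal_le_of_plus` — `q` misses the vertex ideal `(a tⁿ : n ≥ 1, a ∈ Iₙ)`;
and their spelling for a Rees algebra `R` on a scheme `Y` and an affine open `U` (`R.cobordantPlus U`, `R.cobordantPlusι U`,
`R.cobordantStrictTransform U X` unfold to the above with `A := Γ(Y,U)`, `I := R.chartIdeals U`, `𝔞 := X(U)`):
`ReesAlgebraData.exists_stalk_ringEquiv_cobordantPlus`, `ReesAlgebraData.primeIdealOf_cobordantPlusι_asIdeal`,
`ReesAlgebraData.cobordantPlusι_mem`.  The remaining two thirds of (γ2) (transfer to the GAME ring over `𝒪_{Y,η} = Γ(U)_𝔭` by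
res-type-048's `exists_prime_extReesAlgebra_ringEquiv_localization_T`, the factorisation `f = t⁻ᵃ g` and the order read-off) are the
holder's file `AQSHeightTwoPlusStalk.lean`.

Def-free helper (`--supports stmt-ResolutionOfSingularities-19897`); OURS bookkeeping — nothing here is a claim about resolution of
singularities in positive characteristic or about the cited paper beyond its typed statement.  AI-written; weaker than expert review.
[cite: Wlodarczyk2022, Def. 2.3.5; 3.3.12]
-/

noncomputable section

set_option linter.dupNamespace false -- mandated namespace of this single-conjunct summit

open CategoryTheory AlgebraicGeometry TopologicalSpace IsLocalRing
open scoped LaurentPolynomial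
open Literature.AlgebraicGeometry.Resolution
open Summit.ResolutionOfSingularities.ResolutionOfSingularities.Theorems
open Summit.ResolutionOfSingularities.ResolutionOfSingularities.Cruxes.HypersurfaceCentreConstruction.LocalEngine

namespace Summit.ResolutionOfSingularities.ResolutionOfSingularities.Theorems.AQSHeightTwo

/-! ## The affine model: any ring `A`, any ideal sequence `I` -/

section Affine

variable {A : Type} [CommRing A] (I : ℕ → Ideal A)

/-- The strict transform `σˢ(𝔞) ≤ A[t⁻¹, Iₙ tⁿ]` is the `t⁻¹`-saturation `⋃ₙ (𝔞 · A[t⁻¹, Iₙ tⁿ] : (t⁻¹)ⁿ)`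
(`extReesAlgebra.mem_strictTransform_iff`, spelled as a supremum of colon ideals). [cite: Wlodarczyk2022, 3.3.12] -/
theorem strictTransform_eq_iSup_colon (𝔞 : Ideal A) :
    extReesAlgebra.strictTransform I 𝔞 =
      ⨆ n : ℕ, (𝔞.map (algebraMap A (extReesAlgebra I))).colon {extReesAlgebra.tInv I ^ n} := by
  ext g
  rw [extReesAlgebra.mem_strictTransform_iff, mem_iSup_ideal_colon_singleton_pow_iff]

/-- **(III)** A point of `B₊ = B ∖ Vert` read as a prime `q` of `A[t⁻¹, Iₙ tⁿ]` does not contain the vertex ideal. [folklore] -/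
theorem not_vertexIdeal_le_of_plus (b : affineCobordantBlowup.plus I) (q : PrimeSpectrum (extReesAlgebra I))
    (hq : (affineCobordantBlowup.plusOpens I).ι b = q) : ¬ extReesAlgebra.vertexIdeal I ≤ q.asIdeal := by
  subst hq
  have hb : b.1 ∉ ((affineBlowup.idealSheaf (extReesAlgebra.vertexIdeal I)).support :
      Set (Spec (.of (extReesAlgebra I)))) := b.2
  rw [affineBlowup.support_idealSheaf] at hb
  exact fun hle => hb hle

/-- **(II)** The base point `σ₊(b) ∈ Spec A` of a point `b` of `B₊`, read as the prime `q` of `A[t⁻¹, Iₙ tⁿ]`, is `q ∩ A`.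
[folklore] -/
theorem plusπ_apply_asIdeal (b : affineCobordantBlowup.plus I) (q : PrimeSpectrum (extReesAlgebra I))
    (hq : (affineCobordantBlowup.plusOpens I).ι b = q) :
    (affineCobordantBlowup.plusπ I b).asIdeal = q.asIdeal.comap (algebraMap A (extReesAlgebra I)) := by
  subst hq
  rfl

/-- **(I) — the affine stalk model.**  For a point `b` of the cobordant blow-up `B₊ = Spec A[t⁻¹, Iₙ tⁿ] ∖ Vert`, read as the prime
`q` of `A[t⁻¹, Iₙ tⁿ]`, a ring isomorphism `Ψ₀ : 𝒪_{B₊, b} ≃+* (A[t⁻¹, Iₙ tⁿ])_q` carrying, for every ideal `𝔞 ≤ A`, the stalk of the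
strict transform `σˢ(𝔞)|_{B₊}` onto the `t⁻¹`-saturation `⋃ₙ (𝔞 · (A[t⁻¹, Iₙ tⁿ])_q : (t⁻¹/1)ⁿ)` (stalk map of the open immersion
`B₊ ↪ B`, then `𝒪_{Spec S, q} ≅ S_q`; the strict transform is the saturation upstairs and saturation commutes with localisation).
[cite: Wlodarczyk2022, 3.3.12] -/
theorem exists_stalk_ringEquiv_plus (b : affineCobordantBlowup.plus I) (q : PrimeSpectrum (extReesAlgebra I))
    (hq : (affineCobordantBlowup.plusOpens I).ι b = q) :
    ∃ Ψ₀ : (affineCobordantBlowup.plus I).presheaf.stalk b ≃+* Localization.AtPrime q.asIdeal,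
      ∀ 𝔞 : Ideal A,
        (stalkIdeal (affineCobordantBlowup.strictTransformPlus I 𝔞) b).map
            (Ψ₀ : (affineCobordantBlowup.plus I).presheaf.stalk b →+* Localization.AtPrime q.asIdeal) =
          ⨆ n : ℕ, ((𝔞.map (algebraMap A (extReesAlgebra I))).map
            (algebraMap (extReesAlgebra I) (Localization.AtPrime q.asIdeal))).colon
            {algebraMap (extReesAlgebra I) (Localization.AtPrime q.asIdeal) (extReesAlgebra.tInv I) ^ n} := by
  subst hq
  -- K4-A along the open immersion `B₊ ↪ B = Spec A[t⁻¹, Iₙ tⁿ]`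
  let E₂ : (Spec (CommRingCat.of (extReesAlgebra I))).presheaf.stalk ((affineCobordantBlowup.plusOpens I).ι b) ≃+*
      (affineCobordantBlowup.plus I).presheaf.stalk b :=
    (asIso ((affineCobordantBlowup.plusOpens I).ι.stalkMap b)).commRingCatIsoToRingEquiv
  -- K4-B with the localisation model on `Spec A[t⁻¹, Iₙ tⁿ]`
  have hE30 := exists_stalk_ringEquiv_localization_Spec (S := extReesAlgebra I) ((affineCobordantBlowup.plusOpens I).ι b)
  obtain ⟨E₃, hE₃⟩ := hE30
  refine ⟨E₂.symm.trans E₃, fun 𝔞 => ?_⟩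
  -- along `B₊ ↪ B`
  have hc := stalkIdeal_comap_eq_map_ringEquiv (affineCobordantBlowup.plusOpens I).ι
    (affineCobordantBlowup.idealSheaf I (extReesAlgebra.strictTransform I 𝔞)) b
  have hc' : stalkIdeal (affineCobordantBlowup.strictTransformPlus I 𝔞) b =
      (stalkIdeal (affineCobordantBlowup.idealSheaf I (extReesAlgebra.strictTransform I 𝔞))
        ((affineCobordantBlowup.plusOpens I).ι b)).map
        (E₂ : (Spec (CommRingCat.of (extReesAlgebra I))).presheaf.stalk ((affineCobordantBlowup.plusOpens I).ι b) →+*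
          (affineCobordantBlowup.plus I).presheaf.stalk b) := hc
  have h1 : (stalkIdeal (affineCobordantBlowup.strictTransformPlus I 𝔞) b).map
      (E₂.symm : (affineCobordantBlowup.plus I).presheaf.stalk b →+*
        (Spec (CommRingCat.of (extReesAlgebra I))).presheaf.stalk ((affineCobordantBlowup.plusOpens I).ι b)) =
      stalkIdeal (affineCobordantBlowup.idealSheaf I (extReesAlgebra.strictTransform I 𝔞))
        ((affineCobordantBlowup.plusOpens I).ι b) := by
    rw [hc']
    exact Ideal.map_of_equiv E₂
  -- on `Spec A[t⁻¹, Iₙ tⁿ]` into the localisation (`idealSheaf I J` is `ofIdealTop (J.map ΓSpecIso.inv)` by definition)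
  have h2 : (stalkIdeal (affineCobordantBlowup.idealSheaf I (extReesAlgebra.strictTransform I 𝔞))
      ((affineCobordantBlowup.plusOpens I).ι b)).map
      (E₃ : (Spec (CommRingCat.of (extReesAlgebra I))).presheaf.stalk ((affineCobordantBlowup.plusOpens I).ι b) →+*
        Localization.AtPrime ((affineCobordantBlowup.plusOpens I).ι b).asIdeal) =
      (extReesAlgebra.strictTransform I 𝔞).map
        (algebraMap (extReesAlgebra I) (Localization.AtPrime ((affineCobordantBlowup.plusOpens I).ι b).asIdeal)) :=
    hE₃ (extReesAlgebra.strictTransform I 𝔞)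
  -- the saturation bookkeeping in the localisation
  have h3 : (extReesAlgebra.strictTransform I 𝔞).map
      (algebraMap (extReesAlgebra I) (Localization.AtPrime ((affineCobordantBlowup.plusOpens I).ι b).asIdeal)) =
      ⨆ n : ℕ, ((𝔞.map (algebraMap A (extReesAlgebra I))).map
        (algebraMap (extReesAlgebra I) (Localization.AtPrime ((affineCobordantBlowup.plusOpens I).ι b).asIdeal))).colon
        {algebraMap (extReesAlgebra I) (Localization.AtPrime ((affineCobordantBlowup.plusOpens I).ι b).asIdeal)
          (extReesAlgebra.tInv I) ^ n} := by
    rw [strictTransform_eq_iSup_colon]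
    exact map_iSup_colon_singleton_pow ((affineCobordantBlowup.plusOpens I).ι b).asIdeal
      (Localization.AtPrime ((affineCobordantBlowup.plusOpens I).ι b).asIdeal) _ _
  have h4 : (stalkIdeal (affineCobordantBlowup.strictTransformPlus I 𝔞) b).map
      ((E₂.symm.trans E₃ : (affineCobordantBlowup.plus I).presheaf.stalk b ≃+*
        Localization.AtPrime ((affineCobordantBlowup.plusOpens I).ι b).asIdeal) :
        (affineCobordantBlowup.plus I).presheaf.stalk b →+*
          Localization.AtPrime ((affineCobordantBlowup.plusOpens I).ι b).asIdeal) =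
      ((stalkIdeal (affineCobordantBlowup.strictTransformPlus I 𝔞) b).map
        (E₂.symm : (affineCobordantBlowup.plus I).presheaf.stalk b →+*
          (Spec (CommRingCat.of (extReesAlgebra I))).presheaf.stalk ((affineCobordantBlowup.plusOpens I).ι b))).map
        (E₃ : (Spec (CommRingCat.of (extReesAlgebra I))).presheaf.stalk ((affineCobordantBlowup.plusOpens I).ι b) →+*
          Localization.AtPrime ((affineCobordantBlowup.plusOpens I).ι b).asIdeal) := by
    rw [RingEquiv.coe_ringHom_trans, ← Ideal.map_map]
  rw [h4, h1]
  exact h2.trans h3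

end Affine

/-! ## The spelling for a Rees algebra on a scheme over an affine open -/

section Rees

variable {Y : Scheme.{0}} (R : ReesAlgebraData Y) (U : Y.affineOpens)

/-- The base point `R.cobordantPlusι U b` of a point of `B₊(U)` lies in `U`. [folklore] -/
theorem _root_.Literature.AlgebraicGeometry.Resolution.ReesAlgebraData.cobordantPlusι_mem (b : R.cobordantPlus U) :
    R.cobordantPlusι U b ∈ (U : Y.Opens) := by
  have h := Set.mem_range_self (f := fun p => U.2.fromSpec p)
    (affineCobordantBlowup.plusπ (R.chartIdeals U) b)
  rw [U.2.range_fromSpec] at h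
  exact h

/-- **(II) for `B₊(U)`**: the prime of `Γ(Y,U)` of the base point of `b` is `q ∩ Γ(Y,U)` (`q` the prime of `Γ(U)[t⁻¹, Rₙ(U) tⁿ]` under
`b`). [folklore] -/
theorem _root_.Literature.AlgebraicGeometry.Resolution.ReesAlgebraData.primeIdealOf_cobordantPlusι_asIdeal
    (b : R.cobordantPlus U) (q : PrimeSpectrum (extReesAlgebra (R.chartIdeals U)))
    (hq : (affineCobordantBlowup.plusOpens (R.chartIdeals U)).ι b = q) :
    (U.2.primeIdealOf ⟨R.cobordantPlusι U b, R.cobordantPlusι_mem U b⟩).asIdeal =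
      q.asIdeal.comap (algebraMap Γ(Y, U) (extReesAlgebra (R.chartIdeals U))) := by
  rw [← plusπ_apply_asIdeal (R.chartIdeals U) b q hq]
  congr 1
  apply U.2.fromSpec.isOpenEmbedding.injective
  rw [IsAffineOpen.fromSpec_primeIdealOf]
  rfl

/-- **(III) for `B₊(U)`**. [folklore] -/
theorem _root_.Literature.AlgebraicGeometry.Resolution.ReesAlgebraData.not_vertexIdeal_le_of_cobordantPlus
    (b : R.cobordantPlus U) (q : PrimeSpectrum (extReesAlgebra (R.chartIdeals U)))
    (hq : (affineCobordantBlowup.plusOpens (R.chartIdeals U)).ι b = q) :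
    ¬ extReesAlgebra.vertexIdeal (R.chartIdeals U) ≤ q.asIdeal :=
  not_vertexIdeal_le_of_plus (R.chartIdeals U) b q hq

/-- **(I) for `B₊(U)`** — the stalk of `B₊(U)` at `b` as the local ring `(Γ(U)[t⁻¹, Rₙ(U) tⁿ])_q`, carrying the stalk of the strict
transform `R.cobordantStrictTransform U X` of EVERY ideal sheaf `X` onto the `t⁻¹`-saturation of `X(U)`. [cite: Wlodarczyk2022, 3.3.12] -/
theorem _root_.Literature.AlgebraicGeometry.Resolution.ReesAlgebraData.exists_stalk_ringEquiv_cobordantPlus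
    (b : R.cobordantPlus U) (q : PrimeSpectrum (extReesAlgebra (R.chartIdeals U)))
    (hq : (affineCobordantBlowup.plusOpens (R.chartIdeals U)).ι b = q) :
    ∃ Ψ₀ : (R.cobordantPlus U).presheaf.stalk b ≃+* Localization.AtPrime q.asIdeal,
      ∀ X : Y.IdealSheafData,
        (stalkIdeal (R.cobordantStrictTransform U X) b).map
            (Ψ₀ : (R.cobordantPlus U).presheaf.stalk b →+* Localization.AtPrime q.asIdeal) =
          ⨆ n : ℕ, (((X.ideal U).map (algebraMap Γ(Y, U) (extReesAlgebra (R.chartIdeals U)))).map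
            (algebraMap (extReesAlgebra (R.chartIdeals U)) (Localization.AtPrime q.asIdeal))).colon
            {algebraMap (extReesAlgebra (R.chartIdeals U)) (Localization.AtPrime q.asIdeal)
              (extReesAlgebra.tInv (R.chartIdeals U)) ^ n} := by
  have h := exists_stalk_ringEquiv_plus (R.chartIdeals U) b q hq
  obtain ⟨Ψ₀, hΨ₀⟩ := h
  exact ⟨Ψ₀, fun X => hΨ₀ (X.ideal U)⟩

end Rees

end Summit.ResolutionOfSingularities.ResolutionOfSingularities.Theorems.AQSHeightTwo

end
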